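import Summits.HodgeConjecture.CorCM.Census.CoinvariantFibre
import Summits.HodgeConjecture.CorCM.Census.BlockParityExactRank

/-!
# The coinvariant fibre `φ₂(G, c)`, II: the COINVARIANT FLOOR `|S| ≥ φ₂` for families of Hodge vectors, and `φ₂ ≥ β − 1 − δ`

COR-CM (cell `pub-hodgecm2`), count-neutral kernel combinatorics by the binder seat b09 (gen 29; lane COINVARIANT-FLOOR),
part II, sequel of `Census/CoinvariantFibre.lean` (I).  Theorems + one bookkeeping definition (`par2`, the block parities on
`𝔽₂[types]`); no `decide` beyond `(1 : 𝔽₂) + 1 = 0`, no certificate, no named fact, no `sorry`.  HONEST FRAMING: `HC_CM` is NOT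
proved; nothing here is a period or a headline.

SETTING of part I: `G` finite, `c` a central involution, `ℤ[types] = CMF G c →₀ ℤ`, faces `gfaceSet`, pairs `pairSet`, the Hodge span
`hodgeSpan = ℤ⟨faces⟩ + ℤ⟨pairs⟩ = {integer Hodge vectors}`, and mod `2`: `hodge2 = face2 + pair2 ⊇ rad2 = pair2 + aug2`, the
coinvariant fibre `fibre = hodge2 / rad2 ≅ (Λ ⊗ 𝔽₂)_G` of dimension `φ₂(G, c) = fibreTwo`.

CONTENT.
* §1 **The mod-2 floor** (`hodge2_le_rad2_sup_span`, `fibreTwo_le_card_two`): if a finite family `S ⊆ hodge2` generates the faces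
  modulo pairs over `𝔽₂[G]` (`faces2 ⊆ pair2 + 𝔽₂⟨translates of S⟩`), then already `hodge2 ≤ rad2 + 𝔽₂⟨S⟩` (a translate `s·Q⁻¹` is
  `s` plus a coboundary of a Hodge vector, which lies in `rad2` by part I), hence **`φ₂ ≤ |S|`**.
* §2 **THE COINVARIANT FLOOR** (`fibreTwo_le_card`): if a finite family `S` of integer HODGE vectors (`S ⊆ hodgeSpan`: faces,
  `σ`-reads of rank-four faces, Hodge-weight relations, …) satisfies `faces ⊆ P₀ + ℤ[G]·S` with `P₀ ⊆ ℤ⟨pairs⟩`, then **`|S| ≥ φ₂(G, c)`**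
  — reduce mod `2` and apply §1.  In André-3's words: `μ ≥ μ_F ≥ … ≥ fibre₂` — the lower half of the law (D), for every `(G, c)`,
  no census; `fibreTwo_le_card_of_faces` is the face form (`μ_F ≥ φ₂`).  Part VIII's one-functional engine
  (`BlockParity.finrank_span_le_card_of_invariantOn`) is the shadow of this under any functional killing `rad2`.
* §3 **DOMINATION OF THE PARITY FLOOR** (`finrank_span_par_le_fibreTwo`, `card_block_le_fibreTwo_add`): the block parities
  `par` factor through `𝔽₂[types] → 𝔽₂[types]/rad2` (`par2`, `rad2_le_ker_par2`), so `dim_𝔽₂ span par(faces) ≤ φ₂`, i.e. with gen 28's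
  exact rank (`BlockParity.finrank_span_par_gfaceSet_add`) **`β − 1 − δ ≤ φ₂`**: the parity floor of `Census/BlockParityRelations`
  is a COROLLARY of the coinvariant floor for Hodge families, and `φ₂` is strictly larger exactly on the «divided parity» rows (gen 28
  numerics, all `|G| ≤ 32`: `Q₈ 2 > 0`, `ℤ/4×ℤ/2 (c ∈ 2G) 2 > 1`, `ℤ/8×ℤ/2 (c = (4,0)) 17 > 16`, `Q₁₆ 16 > 14`, `SD₁₆ 19 > 18`, `M₁₆ 17 > 16`,
  `Q₈×ℤ/2 (c = −1) 18 > 16`, `Dic₆ 172 > 170`, …; equality on every cyclic row `6 ≤ |G| ≤ 32`).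
* §4 **`φ₂` faces always suffice modulo the radical** (`exists_faces2_card_eq_fibreTwo`): there are `φ₂` faces mod `2` with
  `hodge2 ≤ rad2 + 𝔽₂⟨them⟩` (lift a basis of the fibre through `face2 ↠ fibre`); part III (`Census/CoinvariantTwoGroups.lean`) upgrades
  this to honest generation `face2 ≤ pair2 + 𝔽₂[G]·⟨them⟩` when `G` is a `2`-group (Nakayama).

## References
* [Pohlmann1968] H. Pohlmann, Algebraic cycles on abelian varieties of complex multiplication type, Ann. of Math. 88 (1968), Thm 1.
* [Milne1999] J. S. Milne, Lefschetz motives and the Tate conjecture, Compositio Math. 117 (1999), Prop. 2.1, p. 54.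
-/

namespace Summit.HodgeConjecture.CorCM.Census.Coinvariant

open Finset
open Summit.HodgeConjecture.CorCM.Prior.AllgGroup.RfwfAllgGroup
open Summit.HodgeConjecture.CorCM.Census.BlockParity

noncomputable section

variable {G : Type*} [Group G] [Fintype G] [DecidableEq G] (c : G)

/-! ## §1 The mod-2 floor -/

/-- Translates of members of `hodge2` lie in `rad2 + 𝔽₂⟨S⟩` (central `c`). [folklore] -/
theorem span_translates2_le (hc2 : c * c = 1) (hcen : ∀ x : G, x * c = c * x) (S : Finset (CMF G c →₀ ZMod 2))
    (hS : (S : Set (CMF G c →₀ ZMod 2)) ⊆ hodge2 c hc2) :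
    Submodule.span (ZMod 2) (translates2 c S) ≤ rad2 c hc2 ⊔ Submodule.span (ZMod 2) (S : Set (CMF G c →₀ ZMod 2)) := by
  rw [Submodule.span_le]
  rintro _ ⟨Q, s, hs, rfl⟩
  have e : Finsupp.mapDomain (rt c Q) s = (Finsupp.mapDomain (rt c Q) s - s) + s := by abel
  rw [SetLike.mem_coe, e]
  exact Submodule.add_mem _ (Submodule.mem_sup_left (mapDomain_rt_sub_mem_rad2 c hc2 hcen Q (hS hs)))
    (Submodule.mem_sup_right (Submodule.subset_span hs))

/-- **Mod-2 reduction of the generation hypothesis**: if `S ⊆ hodge2` and `faces2 ⊆ pair2 + 𝔽₂[G]·S`, then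
`hodge2 ≤ rad2 + 𝔽₂⟨S⟩`. [folklore] -/
theorem hodge2_le_rad2_sup_span (hc2 : c * c = 1) (hcen : ∀ x : G, x * c = c * x) (S : Finset (CMF G c →₀ ZMod 2))
    (hS : (S : Set (CMF G c →₀ ZMod 2)) ⊆ hodge2 c hc2)
    (hX : faces2 c hc2 ⊆ ↑(pair2 c ⊔ Submodule.span (ZMod 2) (translates2 c S))) :
    hodge2 c hc2 ≤ rad2 c hc2 ⊔ Submodule.span (ZMod 2) (S : Set (CMF G c →₀ ZMod 2)) := by
  have hF : face2 c hc2 ≤ rad2 c hc2 ⊔ Submodule.span (ZMod 2) (S : Set (CMF G c →₀ ZMod 2)) := by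
    rw [face2, Submodule.span_le]
    exact hX.trans (SetLike.coe_subset_coe.mpr
      (sup_le ((pair2_le_rad2 c hc2).trans le_sup_left) (span_translates2_le c hc2 hcen S hS)))
  exact sup_le hF ((pair2_le_rad2 c hc2).trans le_sup_left)

/-- **The mod-2 floor**: a family `S ⊆ hodge2` with `faces2 ⊆ pair2 + 𝔽₂[G]·S` has `|S| ≥ φ₂(G, c)`. [folklore] -/
theorem fibreTwo_le_card_two (hc2 : c * c = 1) (hcen : ∀ x : G, x * c = c * x) (S : Finset (CMF G c →₀ ZMod 2))
    (hS : (S : Set (CMF G c →₀ ZMod 2)) ⊆ hodge2 c hc2)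
    (hX : faces2 c hc2 ⊆ ↑(pair2 c ⊔ Submodule.span (ZMod 2) (translates2 c S))) : fibreTwo c hc2 ≤ S.card :=
  (fibreTwo_le_finrank_of_hodge2_le c hc2 (hodge2_le_rad2_sup_span c hc2 hcen S hS hX)).trans
    (finrank_span_finset_le_card S)

/-! ## §2 The coinvariant floor for families of integer Hodge vectors -/

/-- Reduction of the integral generation hypothesis: `faces ⊆ P₀ + ℤ[G]·S`, `P₀ ⊆ ℤ⟨pairs⟩` gives
`faces2 ⊆ pair2 + 𝔽₂[G]·(red S)`. [folklore] -/
theorem faces2_subset_of_gfaceSet_subset (hc2 : c * c = 1) (S : Finset (CMF G c →₀ ℤ)) (P₀ : Submodule ℤ (CMF G c →₀ ℤ))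
    (hP₀ : P₀ ≤ Submodule.span ℤ (pairSet c)) (hX : gfaceSet G c hc2 ⊆ ↑(P₀ ⊔ Submodule.span ℤ (translates c S))) :
    faces2 c hc2 ⊆ ↑(pair2 c ⊔ Submodule.span (ZMod 2) (translates2 c (S.image (red c)))) := by
  classical
  rintro _ ⟨y, hy, rfl⟩
  obtain ⟨q, hq, z, hz, hqz⟩ := Submodule.mem_sup.mp (hX hy)
  rw [SetLike.mem_coe, ← hqz, map_add]
  refine Submodule.add_mem _ (Submodule.mem_sup_left (red_mem_pair2 c (hP₀ hq))) (Submodule.mem_sup_right ?_)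
  refine Submodule.span_mono ?_ (red_mem_span_of_mem_span c hz)
  rintro _ ⟨_, ⟨Q, s, hs, rfl⟩, rfl⟩
  exact ⟨Q, red c s, Finset.mem_image_of_mem _ hs, red_mapDomain c (rt c Q) s⟩

/-- **THE COINVARIANT FLOOR.**  For central `c`: every finite family `S` of integer HODGE vectors (`S ⊆ hodgeSpan`) with
`faces ⊆ P₀ + ℤ[G]·S`, `P₀ ⊆ ℤ⟨pairs⟩`, has **`|S| ≥ φ₂(G, c)`** `= dim_𝔽₂ (Λ ⊗ 𝔽₂)_G` — the lower half `μ ≥ fibre₂` of André-3's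
law, uniformly in `(G, c)`, no census. [folklore] -/
theorem fibreTwo_le_card (hc2 : c * c = 1) (hcen : ∀ x : G, x * c = c * x) (S : Finset (CMF G c →₀ ℤ))
    (P₀ : Submodule ℤ (CMF G c →₀ ℤ)) (hP₀ : P₀ ≤ Submodule.span ℤ (pairSet c))
    (hS : (S : Set (CMF G c →₀ ℤ)) ⊆ hodgeSpan c hc2)
    (hX : gfaceSet G c hc2 ⊆ ↑(P₀ ⊔ Submodule.span ℤ (translates c S))) : fibreTwo c hc2 ≤ S.card := by
  classical
  have hS2 : ((S.image (red c) : Finset (CMF G c →₀ ZMod 2)) : Set (CMF G c →₀ ZMod 2)) ⊆ hodge2 c hc2 := by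
    intro x hx
    obtain ⟨s, hs, rfl⟩ := Finset.mem_image.mp (Finset.mem_coe.mp hx)
    exact red_mem_hodge2 c hc2 (hS hs)
  exact (fibreTwo_le_card_two c hc2 hcen (S.image (red c)) hS2 (faces2_subset_of_gfaceSet_subset c hc2 S P₀ hP₀ hX)).trans
    Finset.card_image_le

/-- **Face form** (`μ_F ≥ φ₂`): a finite set `S` of FACES with `faces ⊆ ℤ⟨pairs⟩ + ℤ[G]·S` has `|S| ≥ φ₂(G, c)`. [folklore] -/
theorem fibreTwo_le_card_of_faces (hc2 : c * c = 1) (hcen : ∀ x : G, x * c = c * x) (S : Finset (CMF G c →₀ ℤ))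
    (hS : (S : Set (CMF G c →₀ ℤ)) ⊆ gfaceSet G c hc2)
    (hX : gfaceSet G c hc2 ⊆ ↑(Submodule.span ℤ (pairSet c) ⊔ Submodule.span ℤ (translates c S))) :
    fibreTwo c hc2 ≤ S.card :=
  fibreTwo_le_card c hc2 hcen S _ le_rfl (hS.trans (gfaceSet_subset_hodgeSpan c hc2)) hX

/-! ## §3 Domination: the block parities factor through the coinvariant fibre, `β − 1 − δ ≤ φ₂` -/

/-- The block parities on `𝔽₂[types]`: `[Ψ] ↦ e_{blk Ψ}`. [folklore] -/
def par2 : (CMF G c →₀ ZMod 2) →ₗ[ZMod 2] (Block c → ZMod 2) :=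
  Finsupp.linearCombination (ZMod 2) fun Ψ => Pi.single (blk c Ψ) (1 : ZMod 2)

/-- `par2 [Ψ]·a = a · e_{blk Ψ}`. [folklore] -/
@[simp] theorem par2_single (Ψ : CMF G c) (a : ZMod 2) :
    par2 c (Finsupp.single Ψ a) = a • Pi.single (blk c Ψ) (1 : ZMod 2) := by
  simp [par2, Finsupp.linearCombination_single]

/-- **`par = par2 ∘ red`**: the integral block parities factor through reduction mod `2`. [folklore] -/
theorem par2_red (y : CMF G c →₀ ℤ) : par2 c (red c y) = par c y := by
  induction y using Finsupp.induction_linear with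
  | zero => rw [map_zero, map_zero, map_zero]
  | add f g hf hg => rw [map_add, map_add, map_add, hf, hg]
  | single Ψ n => rw [red_single, par2_single, par_single, Int.cast_smul_eq_zsmul]

/-- `par2` is base-change invariant. [folklore] -/
theorem par2_mapDomain_rt (Q : G) (x : CMF G c →₀ ZMod 2) : par2 c (Finsupp.mapDomain (rt c Q) x) = par2 c x := by
  unfold par2
  rw [Finsupp.linearCombination_mapDomain]
  have h : ((fun Ψ : CMF G c => (Pi.single (blk c Ψ) (1 : ZMod 2) : Block c → ZMod 2)) ∘ rt c Q) =
      fun Ψ : CMF G c => (Pi.single (blk c Ψ) (1 : ZMod 2) : Block c → ZMod 2) := by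
    funext Ψ; simp
  rw [h]

/-- `par2` kills the pairs mod `2`. [folklore] -/
theorem pair2_le_ker_par2 : pair2 c ≤ LinearMap.ker (par2 c) := by
  rw [pair2, Submodule.span_le]
  rintro _ ⟨_, ⟨Ψ, rfl⟩, rfl⟩
  rw [SetLike.mem_coe, LinearMap.mem_ker, red_pair, map_add, par2_single, par2_single, blk_rt, one_smul, ← Pi.single_add]
  have h : (1 : ZMod 2) + 1 = 0 := by decide
  rw [h, Pi.single_zero]

/-- `par2` kills the coboundaries. [folklore] -/
theorem aug2_le_ker_par2 (hc2 : c * c = 1) : aug2 c hc2 ≤ LinearMap.ker (par2 c) := by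
  rw [aug2, Submodule.span_le]
  rintro _ ⟨Q, x, -, rfl⟩
  rw [SetLike.mem_coe, LinearMap.mem_ker, map_sub, par2_mapDomain_rt, sub_self]

/-- **`rad2 ≤ ker par2`**: the block parities factor through `𝔽₂[types]/rad2`. [folklore] -/
theorem rad2_le_ker_par2 (hc2 : c * c = 1) : rad2 c hc2 ≤ LinearMap.ker (par2 c) :=
  sup_le (pair2_le_ker_par2 c) (aug2_le_ker_par2 c hc2)

/-- The `𝔽₂`-span of the integral block parities of the faces is `par2(face2)`. [folklore] -/
theorem span_par_gfaceSet_eq_map (hc2 : c * c = 1) :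
    Submodule.span (ZMod 2) (par c '' gfaceSet G c hc2) = (face2 c hc2).map (par2 c) := by
  rw [face2, Submodule.map_span, faces2, Set.image_image]
  congr 1
  ext v
  constructor
  · rintro ⟨y, hy, rfl⟩; exact ⟨y, hy, par2_red c y⟩
  · rintro ⟨y, hy, rfl⟩; exact ⟨y, hy, (par2_red c y).symm⟩

/-- **`dim_𝔽₂ span par(faces) ≤ φ₂(G, c)`**: no base-change-invariant parity argument beats the coinvariant fibre. [folklore] -/
theorem finrank_span_par_le_fibreTwo (hc2 : c * c = 1) :
    Module.finrank (ZMod 2) ↥(Submodule.span (ZMod 2) (par c '' gfaceSet G c hc2)) ≤ fibreTwo c hc2 := by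
  rw [span_par_gfaceSet_eq_map]
  have hfac : (face2 c hc2).map (par2 c) =
      (Submodule.map (rad2 c hc2).mkQ (face2 c hc2)).map ((rad2 c hc2).liftQ (par2 c) (rad2_le_ker_par2 c hc2)) := by
    rw [← Submodule.map_comp, Submodule.liftQ_mkQ]
  rw [hfac, fibreTwo, fibre_eq_map_face2]
  exact Submodule.finrank_map_le _ _

/-- **DOMINATION OF THE PARITY FLOOR: `β(G, c) ≤ φ₂(G, c) + 1 + δ(G, c)`**, i.e. `β − 1 − δ ≤ φ₂` — with gen 28's exact rank of
the block parities on the face lattice (`BlockParity.finrank_span_par_gfaceSet_add`). [folklore] -/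
theorem card_block_le_fibreTwo_add (hc2 : c * c = 1) (T₀ : CMF G c) :
    Fintype.card (Block c) ≤ fibreTwo c hc2 + 1 + wdelta c T₀ := by
  have h1 := finrank_span_par_gfaceSet_add c hc2 T₀
  have h2 := finrank_span_par_le_fibreTwo c hc2
  omega

/-- `δ`-free form: `β(G, c) ≤ φ₂(G, c) + 2`. [folklore] -/
theorem card_block_le_fibreTwo_add_two (hc2 : c * c = 1) (hc1 : c ≠ 1) : Fintype.card (Block c) ≤ fibreTwo c hc2 + 2 := by
  obtain ⟨T, hT⟩ := exists_isCMF c hc2 hc1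
  have h := card_block_le_fibreTwo_add c hc2 ⟨T, hT⟩
  have h1 := wdelta_le_one c ⟨T, hT⟩
  omega

/-! ## §4 `φ₂` faces always suffice modulo the radical -/

section Lift

variable {K : Type*} [DivisionRing K] {V W : Type*} [AddCommGroup V] [Module K V] [AddCommGroup W] [Module K W]

/-- **Basis lifting.**  For a linear map `q` and a set `F`, some finite `S ⊆ F` with `|S| = dim q(K⟨F⟩)` has `K⟨F⟩ ≤ ker q + K⟨S⟩`
(lift a basis of `q(K⟨F⟩)` extracted from `q(F)`). [folklore] -/
theorem exists_subset_card_eq_finrank_map [Module.Finite K W] (q : V →ₗ[K] W) (F : Set V) :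
    ∃ S : Finset V, ↑S ⊆ F ∧ S.card = Module.finrank K ↥((Submodule.span K F).map q) ∧
      Submodule.span K F ≤ LinearMap.ker q ⊔ Submodule.span K (S : Set V) := by
  classical
  obtain ⟨b, hb, hspan, hli⟩ := exists_linearIndependent K (q '' F)
  have hbfin : b.Finite := hli.setFinite
  have hsec : ∀ v : b, ∃ x ∈ F, q x = v.1 := fun v => by
    obtain ⟨x, hx, hxv⟩ := hb v.2
    exact ⟨x, hx, hxv⟩
  choose sec hsec_mem hsec_eq using hsec
  have hinj : Function.Injective sec := fun v w h => Subtype.ext (by rw [← hsec_eq v, ← hsec_eq w, h])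
  haveI : Fintype b := hbfin.fintype
  have himage : q '' ((Finset.univ.image sec : Finset V) : Set V) = b := by
    ext w
    simp only [Finset.coe_image, Finset.coe_univ, Set.image_univ, Set.mem_image, Set.mem_range]
    constructor
    · rintro ⟨_, ⟨v, rfl⟩, rfl⟩; rw [hsec_eq]; exact v.2
    · intro hw; exact ⟨sec ⟨w, hw⟩, ⟨⟨w, hw⟩, rfl⟩, hsec_eq ⟨w, hw⟩⟩
  refine ⟨Finset.univ.image sec, ?_, ?_, ?_⟩
  · intro x hx
    obtain ⟨v, -, rfl⟩ := Finset.mem_image.mp hx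
    exact hsec_mem v
  · rw [Finset.card_image_of_injective _ hinj, Finset.card_univ, Submodule.map_span, ← hspan,
      finrank_span_set_eq_card hli, Set.toFinset_card]
  · rw [Submodule.span_le]
    intro f hf
    have hqf : q f ∈ (Submodule.span K ((Finset.univ.image sec : Finset V) : Set V)).map q := by
      rw [Submodule.map_span, himage, hspan]
      exact Submodule.subset_span ⟨f, hf, rfl⟩
    obtain ⟨s, hs, hqs⟩ := Submodule.mem_map.mp hqf
    have e : f = (f - s) + s := by abel
    rw [SetLike.mem_coe, e]
    refine Submodule.add_mem _ (Submodule.mem_sup_left ?_) (Submodule.mem_sup_right hs)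
    rw [LinearMap.mem_ker, map_sub, hqs, sub_self]

end Lift

/-- **`φ₂` faces suffice modulo the radical**: there are `φ₂(G, c)` faces mod `2` with `hodge2 ≤ rad2 + 𝔽₂⟨them⟩` — the upper half
of «`φ₂ = min |S|` over families with `hodge2 ≤ rad2 + 𝔽₂⟨S⟩`» (the lower half is `fibreTwo_le_finrank_of_hodge2_le`). [folklore] -/
theorem exists_faces2_card_eq_fibreTwo (hc2 : c * c = 1) :
    ∃ S : Finset (CMF G c →₀ ZMod 2), ↑S ⊆ faces2 c hc2 ∧ S.card = fibreTwo c hc2 ∧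
      hodge2 c hc2 ≤ rad2 c hc2 ⊔ Submodule.span (ZMod 2) (S : Set (CMF G c →₀ ZMod 2)) := by
  obtain ⟨S, hSF, hcard, hle⟩ := exists_subset_card_eq_finrank_map (rad2 c hc2).mkQ (faces2 c hc2)
  refine ⟨S, hSF, ?_, ?_⟩
  · rw [hcard, fibreTwo, fibre_eq_map_face2]; rfl
  · rw [Submodule.ker_mkQ] at hle
    exact sup_le hle ((pair2_le_rad2 c hc2).trans le_sup_left)

end

end Summit.HodgeConjecture.CorCM.Census.Coinvariant
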